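/-
Copyright: pub-rosobs cell (Resolution Observatory), carver gen 41.  Companion file; statements OURS, in
the cell's polynomial weighted-centre model `W(f)`.  Instrument — NOT a resolution theorem.
-/
import Literature.AlgebraicGeometry.Resolution.WeightedCentrePureHandleFamily
import Literature.AlgebraicGeometry.Resolution.WeightedCentreTwistExhaustion
import HarnessLib

/-!
# A handle and a higher pure power: `max W(X_a^e + X_b^m X_c) = (m+1, m+1, e)` (`1 ≤ m`, `m + 1 < e`)

[cite: AbramovichTemkinWlodarczyk2024, Thm. 5.3.1 (2)–(3) (p. 1578) (`inv = max (b₁,…,b_k)` over admissible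
centres), §5.1 (p. 1575)] [cite: CossartJannsenSaito2020, Def. 1.26 / Lemma 1.27 (`τ`), Def. 8.2 (p. 118),
Def. 8.13, Def. 8.15, Thm. 8.16 (pp. 120–121) (`δ`, solvable vertices, `δ`-preparedness)].

The simplest MIXED instance of the census's pure-plus-handle family law (engine 1, FE33 C136 (d):
`max W(Σ X_i^{e_i} + Σ X_{b_j}^{m_j} X_{c_j}) = sort (CL_p(e) ∪ {m_j + 1, m_j + 1})`), in the polynomial model,
EVERY field `k`, any number of spectator variables: for pairwise distinct `a, b, c`, `1 ≤ m` and `m + 1 < e`,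

  `max W(X_a^e + X_b^m X_c) = (m+1, m+1, e)`  (`isMaxInv_handlePow`),

e.g. the `A_{e-1}` singularities `X_b X_c + X_a^e ↦ (2, 2, e)` (`e ≥ 3`) and `X_b² X_c + X_a^e ↦ (3, 3, e)`
(`e ≥ 4`).  No characteristic hypothesis is needed: the law's `CL_p` acts on a single pure power trivially.

Proof.  The initial form is the handle `X_b^m X_c` (order `m + 1`), and `τ(X_b^m X_c) = 2`
(`hironakaTau_X_pow_mul_X`: an invariant translation `(Y_b + βT)^m (Y_c + γT) = Y_b^m Y_c` has `β = γ = 0` — kill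
`Y_b`, then compare).  With the block `S = {b, c}` of `y`-variables, Hironaka's polyhedron `Δ(f; u; y)` is the
orthant at the single point `(e/(m+1)) ε_a` (`hironakaDelta_handlePow`), so `δ = e/(m+1)`; its vertex is never
solvable (`handlePow_ne_mul`: `X_a^e + X_b^m X_c = (X_b + βX_a^t)^m (X_c + γX_a^t)` is impossible — kill `X_b`, then
`X_c`), i.e. `f` is `δ`-prepared for free in every characteristic (`isDeltaPrepared_handlePow`).  The general
first-face-and-vertex bound of `WeightedCentreVertexPreparation` then pins every admissible invariant with small
weights to the prefix `(m+1, m+1)` followed by an entry `≤ (m+1)δ = e`; large weights give a head `< m+1`.  The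
coordinate centre `(X_b^{·}, X_c^{·}, X_a^e)` with weights `(1/(m+1), 1/(m+1), 1/e)` attains `(m+1, m+1, e)`
(`WeightedCentrePureHandleFamily.familyExps_mem`).  Also recorded: `max W(X_b^m X_c) = (m+1, m+1)`
(`isMaxInv_X_pow_mul_X`, generalising `isMaxInv_X_mul_X`).

Relation to the umbrella family of `WeightedCentreStepUmbrella`: `handlePow k a b c e m` is literally
`umbrella k a b c e m = X_a^e + X_b^m X_c` (`handlePow_eq_umbrella`, `rfl`).  The tree's `isMaxInv_umbrella` is the
LOW regime `2 ≤ e ≤ m`, `e ∤ m + 1` (value `(e, m+1, m+1)`: the pure power is the initial form); this file adds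
the HIGH regime `e > m + 1` (value `(m+1, m+1, e)`: the handle is the initial form; `isMaxInv_umbrella_high`) and
the HOMOGENEOUS case `e = m + 1` (value `(m+1, m+1, m+1)` from `τ(umbrella) = 3`; `isMaxInv_umbrella_self`), both
in every characteristic, and re-proves the LOW regime `2 ≤ e ≤ m` WITHOUT the divisibility hypothesis and in
EVERY characteristic (`isMaxInv_umbrella_low`): `δ`-preparedness holds for every `e ≥ 2` because the vertex
`(mε_b + ε_c)/e` is never a lattice point (`isDeltaPrepared_umbrella_of_two_le`), and the `δ`-face count is obtained
by EXHAUSTION OF TWISTS (`WeightedCentreTwistExhaustion.hironakaTau_deltaInitial_le_of_forall_twist`): no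
degree-`δ` twist `Y_a ↦ Y_a + Ξ(U)` of the umbrella hides a `u`-direction, in any characteristic
(`eq_zero_of_mem_invarianceSpace_twist_umbrella`: after the shift `Y_a ↦ Y_a − Ξ` and killing `Y_a` the invariance
under a direction `c` with `c_a = 0` reads `D^e + (Y_b + c_bT)^m (Y_c + c_cT) = Y_b^m Y_c`, `D = Ξ(U + cT) − Ξ(U)`;
if `e ≠ 0` in `k`, `∂/∂Y_a` gives `D = 0` and `τ(Y_b^m Y_c) = 2` gives `c_b = c_c = 0`; if `e = 0` in `k`, `∂/∂Y_c`
gives `c_b = 0` and then `∂/∂T` gives `c_c = 0`).  Glued: **`max W(X_a^e + X_b^m X_c) = sort (e, m+1, m+1)` for all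
`e ≥ 2`, `m ≥ 1`, `a, b, c` distinct, in EVERY field** (`isMaxInv_umbrella_law`, `isMaxInv_X_pow_add_X_pow_mul_X`) —
the census's one-pure-power-one-handle law (engine 1, C136 (d)); e.g. `x² + y³z ↦ (2, 4, 4)` in characteristic `2`.
-/

noncomputable section

open MvPolynomial

namespace Literature.AlgebraicGeometry.Resolution.WeightedBlowup

variable {k : Type*} [Field k] {N : ℕ}

/-! ## §1 The polynomial and its Newton data -/

section Defs

variable (k) in
/-- `handlePow k a b c e m = X_a^e + X_b^m X_c`: a pure power plus a handle on disjoint variables.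
[cite: AbramovichTemkinWlodarczyk2024, §5.1 (p. 1575)] -/
def handlePow (a b c : Fin N) (e m : ℕ) : MvPolynomial (Fin N) k := X a ^ e + X b ^ m * X c

end Defs

variable {a b c : Fin N} {e m : ℕ}

/-- Unfolding (plumbing). [cite: AbramovichTemkinWlodarczyk2024, §5.1 (p. 1575)] -/
theorem handlePow_eq : handlePow k a b c e m = X a ^ e + X b ^ m * X c := rfl

/-- The handle is a monomial (plumbing). [folklore] -/
private theorem X_pow_mul_X_eq (b c : Fin N) (m : ℕ) :
    (X b ^ m * X c : MvPolynomial (Fin N) k) = monomial (Finsupp.single b m + Finsupp.single c 1) 1 := by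
  rw [show (X c : MvPolynomial (Fin N) k) = X c ^ 1 from (pow_one _).symm, X_pow_eq_monomial,
    X_pow_eq_monomial, monomial_mul, mul_one]

/-- The two exponents are distinct (they differ at `c`) (plumbing). [folklore] -/
private theorem hExp_ne_single (hac : a ≠ c) (hbc : b ≠ c) :
    (Finsupp.single b m + Finsupp.single c 1 : Fin N →₀ ℕ) ≠ Finsupp.single a e := by
  intro h
  have := congrArg (fun d => d c) h
  simp only [Finsupp.add_apply, Finsupp.single_eq_same, Finsupp.single_apply, if_neg hac, if_neg hbc] at this
  omega

/-- Coefficients of `X_a^e + X_b^m X_c` (plumbing). [folklore] -/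
private theorem coeff_handlePow (d : Fin N →₀ ℕ) :
    coeff d (handlePow k a b c e m) =
      (if Finsupp.single a e = d then 1 else 0) +
        (if Finsupp.single b m + Finsupp.single c 1 = d then 1 else 0) := by
  rw [handlePow, coeff_add, coeff_X_pow, X_pow_mul_X_eq, coeff_monomial]

/-- The support of `X_a^e + X_b^m X_c`. (derived here) [cite: CossartJannsenSaito2020, Def. 8.2 (p. 118)] -/
theorem support_handlePow (hac : a ≠ c) (hbc : b ≠ c) :
    (handlePow k a b c e m).support =
      {Finsupp.single a e, Finsupp.single b m + Finsupp.single c 1} := by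
  classical
  have hne := hExp_ne_single (m := m) (e := e) hac hbc
  ext d
  rw [mem_support_iff, coeff_handlePow, Finset.mem_insert, Finset.mem_singleton]
  constructor
  · intro h
    by_contra hd
    push Not at hd
    rw [if_neg (Ne.symm hd.1), if_neg (Ne.symm hd.2), add_zero] at h
    exact h rfl
  · rintro (rfl | rfl)
    · rw [if_pos rfl, if_neg hne]; norm_num
    · rw [if_pos rfl, if_neg (Ne.symm hne)]; norm_num

/-- The degree of the handle exponent (plumbing). [folklore] -/
private theorem degree_hExp :
    (Finsupp.single b m + Finsupp.single c 1 : Fin N →₀ ℕ).degree = m + 1 := by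
  rw [map_add, Finsupp.degree_single, Finsupp.degree_single]

/-- `ord (X_a^e + X_b^m X_c) = m + 1` for `m + 1 ≤ e`. (derived here) [cite: CossartJannsenSaito2020, Def. 8.2 (p. 118)] -/
theorem monomialOrd_handlePow (hac : a ≠ c) (hbc : b ≠ c) (he : m + 1 ≤ e) :
    monomialOrd (fun _ => 1) (handlePow k a b c e m) = ((m + 1 : ℕ) : ℕ∞) := by
  classical
  have hmem : Finsupp.single b m + Finsupp.single c 1 ∈ (handlePow k a b c e m).support := by
    rw [support_handlePow hac hbc, Finset.mem_insert, Finset.mem_singleton]; exact Or.inr rfl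
  apply le_antisymm
  · refine (monomialOrd_le_weight (fun _ => 1) hmem).trans ?_
    rw [← Finsupp.degree_eq_weight_one, degree_hExp]
  · rw [le_monomialOrd_one_iff]
    intro d hd
    rw [support_handlePow hac hbc, Finset.mem_insert, Finset.mem_singleton] at hd
    rcases hd with rfl | rfl
    · rw [Finsupp.degree_single]; exact he
    · rw [degree_hExp]

/-- The handle is homogeneous of degree `m + 1` (plumbing). [folklore] -/
private theorem isHomogeneous_X_pow_mul_X (b c : Fin N) (m : ℕ) :
    (X b ^ m * X c : MvPolynomial (Fin N) k).IsHomogeneous (m + 1) :=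
  (isHomogeneous_X_pow b m).mul (isHomogeneous_X k c)

/-- The initial form of `X_a^e + X_b^m X_c` is the handle `X_b^m X_c` for `m + 1 < e`. (derived here)
[cite: CossartJannsenSaito2020, Def. 8.2 (p. 118)] -/
theorem homogeneousComponent_handlePow (he : m + 1 < e) :
    homogeneousComponent (m + 1) (handlePow k a b c e m) = X b ^ m * X c := by
  rw [handlePow, map_add, homogeneousComponent_of_mem (isHomogeneous_X_pow a e),
    homogeneousComponent_of_mem (isHomogeneous_X_pow_mul_X b c m), if_neg he.ne, if_pos rfl, zero_add]

/-- The initial form lives on the block `{b, c}` (plumbing). [folklore] -/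
private theorem hFS_handlePow (he : m + 1 < e) :
    ∀ d ∈ (homogeneousComponent (m + 1) (handlePow k a b c e m)).support,
      ∀ x ∉ ({b, c} : Finset (Fin N)), d x = 0 := by
  classical
  intro d hd x hx
  rw [homogeneousComponent_handlePow he, X_pow_mul_X_eq] at hd
  have hd' := Finset.mem_singleton.1 (support_monomial_subset hd)
  simp only [Finset.mem_insert, Finset.mem_singleton, not_or] at hx
  rw [hd', Finsupp.add_apply, Finsupp.single_apply, Finsupp.single_apply, if_neg (Ne.symm hx.1),
    if_neg (Ne.symm hx.2), add_zero]

/-- Block data of the pure monomial with respect to `S = {b, c}` (plumbing). [folklore] -/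
private theorem blockDeg_pure (hab : a ≠ b) (hac : a ≠ c) :
    blockDeg ({b, c} : Finset (Fin N)) (Finsupp.single a e) = 0 := by
  classical
  unfold blockDeg
  refine Finset.sum_eq_zero fun x hx => ?_
  rw [Finset.mem_filter] at hx
  have hxa : x = a := Finset.mem_singleton.1 (Finsupp.support_single_subset hx.1)
  subst hxa
  rcases Finset.mem_insert.1 hx.2 with h | h
  · exact (hab h).elim
  · exact (hac (Finset.mem_singleton.1 h)).elim

/-- Block data of the pure monomial (plumbing). [folklore] -/
private theorem coDeg_pure (hab : a ≠ b) (hac : a ≠ c) :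
    coDeg ({b, c} : Finset (Fin N)) (Finsupp.single a e) = e := by
  have h := blockDeg_add_coDeg ({b, c} : Finset (Fin N)) (Finsupp.single a e)
  rw [blockDeg_pure hab hac, Finsupp.degree_single, zero_add] at h
  exact h

/-- Block data of the pure monomial (plumbing). [folklore] -/
private theorem coPart_pure (hab : a ≠ b) (hac : a ≠ c) :
    coPart ({b, c} : Finset (Fin N)) (Finsupp.single a e) = Finsupp.single a e := by
  classical
  rw [coPart, Finsupp.filter_eq_self_iff]
  intro x hx
  have hxa : x = a := by
    by_contra h
    rw [Finsupp.single_apply, if_neg (Ne.symm h)] at hx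
    exact hx rfl
  subst hxa
  simp only [Finset.mem_insert, Finset.mem_singleton, not_or]
  exact ⟨hab, hac⟩

/-- Block data of the handle monomial (plumbing). [folklore] -/
private theorem coDeg_hExp :
    coDeg ({b, c} : Finset (Fin N)) (Finsupp.single b m + Finsupp.single c 1) = 0 := by
  classical
  unfold coDeg
  refine Finset.sum_eq_zero fun x hx => ?_
  rw [Finset.mem_filter] at hx
  exfalso
  apply hx.2
  rcases Finset.mem_union.1 (Finsupp.support_add hx.1) with h | h
  · rw [Finset.mem_singleton.1 (Finsupp.support_single_subset h)]
    exact Finset.mem_insert_self _ _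
  · rw [Finset.mem_singleton.1 (Finsupp.support_single_subset h)]
    exact Finset.mem_insert_of_mem (Finset.mem_singleton_self _)

/-- Block data of the handle monomial (plumbing). [folklore] -/
private theorem blockDeg_hExp :
    blockDeg ({b, c} : Finset (Fin N)) (Finsupp.single b m + Finsupp.single c 1) = m + 1 := by
  have h := blockDeg_add_coDeg ({b, c} : Finset (Fin N)) (Finsupp.single b m + Finsupp.single c 1)
  rw [coDeg_hExp, add_zero, degree_hExp] at h
  exact h

/-- Block data of the handle monomial (plumbing). [folklore] -/
private theorem coPart_hExp :
    coPart ({b, c} : Finset (Fin N)) (Finsupp.single b m + Finsupp.single c 1) = 0 := by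
  classical
  rw [coPart, Finsupp.filter_eq_zero_iff]
  intro x hx
  simp only [Finset.mem_insert, Finset.mem_singleton, not_or] at hx
  rw [Finsupp.add_apply, Finsupp.single_apply, Finsupp.single_apply, if_neg (Ne.symm hx.1),
    if_neg (Ne.symm hx.2), add_zero]

/-- **Hironaka's `δ(X_a^e + X_b^m X_c; u; (X_b, X_c)) = e/(m+1)`**: the polyhedron `Δ(f; u; y)` is the orthant
at the point `(e/(m+1))·ε_a`. (derived here) [cite: CossartJannsenSaito2020, Def. 8.2 (p. 118) (δ(f; u; y))] -/
theorem hironakaDelta_handlePow (hab : a ≠ b) (hac : a ≠ c) (hbc : b ≠ c) :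
    hironakaDelta {b, c} (m + 1) (handlePow k a b c e m) =
      ((((e : ℚ) / ((m + 1 : ℕ) : ℚ)) : ℚ) : WithTop ℚ) := by
  classical
  have hmem : Finsupp.single a e ∈ (handlePow k a b c e m).support := by
    rw [support_handlePow hac hbc]; exact Finset.mem_insert_self _ _
  apply le_antisymm
  · unfold hironakaDelta
    refine (Finset.inf_le (Finset.mem_filter.2 ⟨hmem, ?_⟩)).trans ?_
    · rw [blockDeg_pure hab hac]; exact Nat.succ_pos m
    · rw [blockDeg_pure hab hac, coDeg_pure hab hac, Nat.sub_zero]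
  · rw [le_hironakaDelta_iff]
    intro d hd hb
    rw [support_handlePow hac hbc, Finset.mem_insert, Finset.mem_singleton] at hd
    rcases hd with rfl | rfl
    · rw [blockDeg_pure hab hac, coDeg_pure hab hac, Nat.sub_zero]
    · rw [blockDeg_hExp] at hb; exact (lt_irrefl _ hb).elim

/-- **The only vertex**: a vertex `v` of `Δ(X_a^e + X_b^m X_c; u; (X_b, X_c))` (integral point, polynomial model)
satisfies `(m+1) • v = e ε_a`. (derived here) [cite: CossartJannsenSaito2020, Def. 8.1 (2), Def. 8.2 (1) (p. 117–118)] -/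
theorem smul_eq_single_of_isVertex_handlePow (hab : a ≠ b) (hac : a ≠ c) (hbc : b ≠ c) {v : Fin N →₀ ℕ}
    (hv : IsVertex {b, c} (m + 1) (handlePow k a b c e m) v) : (m + 1) • v = Finsupp.single a e := by
  classical
  obtain ⟨⟨d, hd, hlt, hco⟩, -⟩ := hv
  rw [support_handlePow hac hbc, Finset.mem_insert, Finset.mem_singleton] at hd
  rcases hd with rfl | rfl
  · rw [blockDeg_pure hab hac, Nat.sub_zero, coPart_pure hab hac] at hco
    exact hco.symm
  · rw [blockDeg_hExp] at hlt; exact (lt_irrefl _ hlt).elim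

/-- A vertex, written out: `v = t ε_a` with `q t = E` (plumbing). [folklore] -/
private theorem exists_eq_single_of_smul_eq₂ {q E : ℕ} (hq : 0 < q) {x : Fin N} {v : Fin N →₀ ℕ}
    (hv : q • v = Finsupp.single x E) : ∃ t, v = Finsupp.single x t ∧ q * t = E := by
  refine ⟨v x, ?_, ?_⟩
  · ext y
    by_cases hy : y = x
    · subst hy; rw [Finsupp.single_eq_same]
    · have := congrArg (fun w => w y) hv
      simp only [Finsupp.smul_apply, smul_eq_mul, Finsupp.single_apply, if_neg (Ne.symm hy)] at this
      rw [Finsupp.single_apply, if_neg (Ne.symm hy)]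
      exact (Nat.mul_eq_zero.1 this).resolve_left hq.ne'
  · have := congrArg (fun w => w x) hv
    simpa only [Finsupp.smul_apply, smul_eq_mul, Finsupp.single_eq_same] using this

/-- The point-initial form at the vertex is the whole polynomial (plumbing).
[cite: CossartJannsenSaito2020, Def. 8.2 (2)–(4) (p. 118)] -/
private theorem pointInitial_handlePow (hab : a ≠ b) (hac : a ≠ c) (hbc : b ≠ c) {v : Fin N →₀ ℕ}
    (hv : (m + 1) • v = Finsupp.single a e) :
    pointInitial {b, c} (m + 1) v (handlePow k a b c e m) = handlePow k a b c e m := by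
  classical
  rw [pointInitial, Finset.filter_true_of_mem, ← (handlePow k a b c e m).as_sum]
  intro d hd
  rw [support_handlePow hac hbc, Finset.mem_insert, Finset.mem_singleton] at hd
  rcases hd with rfl | rfl
  · refine ⟨by rw [blockDeg_pure hab hac]; exact Nat.zero_le _, ?_⟩
    rw [blockDeg_pure hab hac, Nat.sub_zero, hv, coPart_pure hab hac]
  · refine ⟨by rw [blockDeg_hExp], ?_⟩
    rw [blockDeg_hExp, Nat.sub_self, zero_smul, coPart_hExp]

/-! ## §2 `δ`-preparedness: the vertex `(e/(m+1)) ε_a` is never solvable -/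

/-- `killVar` fixes constants (plumbing). [folklore] -/
private theorem killVar_C'' {σ : Type*} [DecidableEq σ] (x : σ) (r : k) :
    killVar x (C r : MvPolynomial σ k) = C r := by
  simp [killVar]

/-- **Non-solvability, every characteristic**: `X_a^e + X_b^m X_c ≠ (X_b + β X_a^t)^m (X_c + γ X_a^t)` for
`m ≥ 1` (kill `X_b`: `X_a^e = (βX_a^t)^m (X_c + γX_a^t)`; kill `X_c` as well and subtract: `(βX_a^t)^m X_c = 0`,
so `β = 0` and then `X_a^e = 0`). (derived here) [cite: CossartJannsenSaito2020, Def. 8.13 (pp. 120–121)] -/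
theorem handlePow_ne_mul (hab : a ≠ b) (hac : a ≠ c) (hbc : b ≠ c) (hm : 1 ≤ m) (β γ : k) (t : ℕ) :
    handlePow k a b c e m ≠ (X b + C β * X a ^ t) ^ m * (X c + C γ * X a ^ t) := by
  classical
  intro h
  have hm0 : m ≠ 0 := by omega
  -- kill `X_b`
  have h1 := congrArg (killVar b) h
  simp only [handlePow, map_add, map_mul, map_pow, killVar_X, killVar_C'', hab, hbc.symm, if_false, if_true,
    zero_pow hm0, zero_mul, add_zero, zero_add] at h1
  -- h1 : X a ^ e = (C β * X a ^ t) ^ m * (X c + C γ * X a ^ t)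
  -- kill `X_c` as well
  have h2 := congrArg (killVar c) h1
  simp only [map_add, map_mul, map_pow, killVar_X, killVar_C'', hac, if_false, if_true, zero_add] at h2
  -- h2 : X a ^ e = (C β * X a ^ t) ^ m * (C γ * X a ^ t)
  have h3 : (C β * X a ^ t) ^ m * X c = (0 : MvPolynomial (Fin N) k) := by
    have h4 := h1.symm.trans h2
    rw [mul_add] at h4
    exact add_right_cancel (h4.trans (zero_add _).symm)
  have h5 : (C β * X a ^ t) ^ m = 0 := (mul_eq_zero.1 h3).resolve_right (X_ne_zero c)
  rw [h5, zero_mul] at h2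
  exact pow_ne_zero e (X_ne_zero a) h2

/-- Unpacking solvability at the vertex (plumbing). [cite: CossartJannsenSaito2020, Def. 8.13 (pp. 120–121)] -/
private theorem eq_mul_of_isSolvableAt (hab : a ≠ b) (hac : a ≠ c) (hbc : b ≠ c) (he : m + 1 < e) {t : ℕ}
    (hsv : (m + 1) • (Finsupp.single a t : Fin N →₀ ℕ) = Finsupp.single a e)
    (hsol : IsSolvableAt {b, c} (m + 1) (handlePow k a b c e m) (Finsupp.single a t)) :
    ∃ β γ : k, handlePow k a b c e m = (X b + C β * X a ^ t) ^ m * (X c + C γ * X a ^ t) := by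
  classical
  obtain ⟨cf, hc⟩ := hsol
  rw [zeroInitial_eq_homogeneousComponent (hFS_handlePow he), homogeneousComponent_handlePow he,
    pointInitial_handlePow hab hac hbc hsv, map_mul, map_pow, aeval_X, aeval_X] at hc
  simp only [Finset.mem_insert, Finset.mem_singleton, true_or, or_true, if_true] at hc
  rw [← X_pow_eq_monomial] at hc
  exact ⟨cf b, cf c, hc⟩

/-- **`X_a^e + X_b^m X_c` is `δ`-prepared with respect to `(y; u) = ((X_b, X_c); rest)`** in EVERY characteristic
(`a, b, c` distinct, `1 ≤ m`, `m + 1 < e`): its only vertex is never solvable. (derived here)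
[cite: CossartJannsenSaito2020, Def. 8.13 (pp. 120–121), Def. 8.15 (p. 121)] -/
theorem isDeltaPrepared_handlePow (hab : a ≠ b) (hac : a ≠ c) (hbc : b ≠ c) (hm : 1 ≤ m) (he : m + 1 < e) :
    IsDeltaPrepared {b, c} (m + 1) (handlePow k a b c e m) := by
  classical
  intro v hv _ hsol
  have hsv := smul_eq_single_of_isVertex_handlePow hab hac hbc hv
  obtain ⟨t, rfl, -⟩ := exists_eq_single_of_smul_eq₂ (Nat.succ_pos m) hsv
  obtain ⟨β, γ, h⟩ := eq_mul_of_isSolvableAt hab hac hbc he hsv hsol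
  exact handlePow_ne_mul hab hac hbc hm β γ t h

/-! ## §3 `τ(X_b^m X_c) = 2` and `max W(X_b^m X_c) = (m+1, m+1)` -/

/-- An invariant translation of `Y_b^m Y_c` is trivial (plumbing).
[cite: CossartJannsenSaito2020, Def. 1.26 / Lemma 1.27 (τ = codimension of the directrix)] -/
private theorem eq_zero_of_translate_handle (hbc : b ≠ c) (hm : 1 ≤ m) {β γ : k}
    (h : ((X (some b) + C β * X none) ^ m * (X (some c) + C γ * X none) : MvPolynomial (Option (Fin N)) k) =
      X (some b) ^ m * X (some c)) : β = 0 ∧ γ = 0 := by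
  classical
  have hm0 : m ≠ 0 := by omega
  have hscb : (some c : Option (Fin N)) ≠ some b := fun h' => hbc (Option.some_injective _ h').symm
  have hnb : (none : Option (Fin N)) ≠ some b := (Option.some_ne_none b).symm
  have hcn : (some c : Option (Fin N)) ≠ none := Option.some_ne_none c
  -- kill `Y_b`
  have h1 := congrArg (killVar (some b)) h
  simp only [map_mul, map_pow, map_add, killVar_X, killVar_C'', if_true, hscb, hnb, if_false, zero_add,
    zero_pow hm0, zero_mul] at h1
  -- h1 : (C β * X none) ^ m * (X (some c) + C γ * X none) = 0
  have hβ : β = 0 := by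
    rcases mul_eq_zero.1 h1 with h1 | h1
    · by_contra hβ
      exact pow_ne_zero m (mul_ne_zero (fun h' => hβ (C_eq_zero.1 h')) (X_ne_zero none)) h1
    · exfalso
      have h1' := congrArg (killVar none) h1
      simp only [map_add, map_mul, map_zero, killVar_X, killVar_C'', hcn, if_false, if_true, mul_zero,
        add_zero] at h1'
      exact X_ne_zero (some c) h1'
  refine ⟨hβ, ?_⟩
  subst hβ
  rw [C_0, zero_mul, add_zero, mul_add] at h
  -- h : Y_b^m Y_c + Y_b^m (γ T) = Y_b^m Y_c
  have h2 : (X (some b) : MvPolynomial (Option (Fin N)) k) ^ m * (C γ * X none) = 0 :=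
    add_left_cancel (h.trans (add_zero _).symm)
  rcases mul_eq_zero.1 h2 with h3 | h3
  · exact (pow_ne_zero m (X_ne_zero _) h3).elim
  · by_contra hγ
    exact mul_ne_zero (fun h' => hγ (C_eq_zero.1 h')) (X_ne_zero none) h3

/-- **`τ(X_b^m X_c) = 2`** (`b ≠ c`, `m ≥ 1`; spectators allowed, every characteristic): no non-zero translation
leaves the monomial invariant. (derived here) [cite: CossartJannsenSaito2020, Def. 1.26 / Lemma 1.27] -/
theorem hironakaTau_X_pow_mul_X (hbc : b ≠ c) (hm : 1 ≤ m) :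
    hironakaTau k {(X b ^ m * X c : MvPolynomial (Fin N) k)} = 2 := by
  classical
  refine (hironakaTau_singleton_eq_card (s := ({b, c} : Finset (Fin N))) ?_ ?_).trans
    (Finset.card_pair hbc)
  · intro x hx
    rcases Finset.mem_union.1 (vars_mul _ _ hx) with h | h
    · have h' := vars_pow _ _ h
      rw [vars_X, Finset.mem_singleton] at h'
      simp [h']
    · rw [vars_X, Finset.mem_singleton] at h
      simp [h]
  · intro w hw x hx
    have h := (mem_invarianceSpace_iff k).1 hw _ (Set.mem_singleton _)
    simp only [map_mul, map_pow, rename_X, translate_X_some] at h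
    obtain ⟨hb, hc⟩ := eq_zero_of_translate_handle hbc hm h
    rcases Finset.mem_insert.1 hx with rfl | hx
    · exact hb
    · rw [Finset.mem_singleton.1 hx]; exact hc

/-- `ord (X_b^m X_c) = m + 1` (plumbing). [cite: CossartJannsenSaito2020, Def. 8.2 (p. 118)] -/
private theorem monomialOrd_X_pow_mul_X (b c : Fin N) (m : ℕ) :
    monomialOrd (fun _ => 1) (X b ^ m * X c : MvPolynomial (Fin N) k) = ((m + 1 : ℕ) : ℕ∞) := by
  rw [X_pow_mul_X_eq, monomialOrd_monomial _ _ one_ne_zero, ← Finsupp.degree_eq_weight_one, degree_hExp]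

/-- The handle centre `(X_b, X_c)` with weights `1/(m+1)` is a centre for `X_b^m X_c` (plumbing).
[cite: AbramovichTemkinWlodarczyk2024, Lemma 5.2.6 (p. 1576), §5.1 (p. 1575)] -/
private theorem isCentreFor_X_pow_mul_X (hbc : b ≠ c) (m : ℕ) :
    IsCentreFor (X b ^ m * X c : MvPolynomial (Fin N) k) AlgEquiv.refl
      (singleWeights b (m + 1) + singleWeights c (m + 1)) := by
  refine ⟨fun x => constantCoeff_X k x, fun x => ?_, isAdmissibleFor_handle hbc m⟩
  have h1 : ∀ (i : Fin N) (x : Fin N), 0 ≤ singleWeights i (m + 1) x := by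
    intro i x
    unfold singleWeights
    split_ifs
    · exact inv_nonneg.2 (by positivity)
    · exact le_rfl
  exact add_nonneg (h1 b x) (h1 c x)

/-- **`max W(X_b^m X_c) = (m+1, m+1)`** (`b ≠ c`, `m ≥ 1`) in any number of variables, every characteristic.
(derived here; `m = 1` is `isMaxInv_X_mul_X`) [cite: AbramovichTemkinWlodarczyk2024, Thm. 5.3.1 (2)–(3) (p. 1578)] -/
theorem isMaxInv_X_pow_mul_X (hbc : b ≠ c) (hm : 1 ≤ m) :
    IsMaxInv (admissibleInvariants (X b ^ m * X c : MvPolynomial (Fin N) k))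
      [((m + 1 : ℕ) : ℚ), ((m + 1 : ℕ) : ℚ)] := by
  have hmem : [((m + 1 : ℕ) : ℚ), ((m + 1 : ℕ) : ℚ)] ∈
      admissibleInvariants (X b ^ m * X c : MvPolynomial (Fin N) k) := by
    have h : [(m : ℚ) + 1, (m : ℚ) + 1] ∈ admissibleInvariants (X b ^ m * X c : MvPolynomial (Fin N) k) :=
      ⟨AlgEquiv.refl, _, isCentreFor_X_pow_mul_X hbc m, exps_handleWeights hbc m⟩
    push_cast
    exact h
  have hτ : hironakaTau k {homogeneousComponent (m + 1) (X b ^ m * X c : MvPolynomial (Fin N) k)} = 2 := by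
    rw [homogeneousComponent_of_mem (isHomogeneous_X_pow_mul_X b c m), if_pos rfl]
    exact hironakaTau_X_pow_mul_X hbc hm
  have h := isMaxInv_replicate_of_mem (f := (X b ^ m * X c : MvPolynomial (Fin N) k)) (ν := m + 1)
    (monomialOrd_X_pow_mul_X b c m) (by rw [hτ]; exact hmem)
  rw [hτ] at h
  exact h

/-! ## §4 The maximum `(m+1, m+1, e)` -/

/-- **`(m+1, m+1, e) ∈ W(X_a^e + X_b^m X_c)`** (`m + 1 < e`): the coordinate centre with weights
`(1/(m+1), 1/(m+1), 1/e)` on `(X_b, X_c, X_a)`. (derived here, from `familyExps_mem`)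
[cite: AbramovichTemkinWlodarczyk2024, Lemma 5.2.6 (p. 1576), §5.1 (p. 1575)] -/
theorem handlePow_inv_mem (hab : a ≠ b) (hac : a ≠ c) (hbc : b ≠ c) (he : m + 1 < e) :
    [((m + 1 : ℕ) : ℚ), ((m + 1 : ℕ) : ℚ), (e : ℚ)] ∈ admissibleInvariants (handlePow k a b c e m) := by
  classical
  have he0 : 0 < e := by omega
  have h := familyExps_mem (k := k) [(a, e)] [(b, m, c)] (by simp [he0]) (by simp [hab, hac, hbc])
  have hf : pureHandle (k := k) [(a, e)] [(b, m, c)] = handlePow k a b c e m := by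
    simp [pureHandle, handlePow]
  have hlt : ¬ ((e : ℚ) ≤ (m : ℚ) + 1) := by
    rw [not_le]; exact_mod_cast he
  have hexps : familyExps [(a, e)] [(b, m, c)] = [((m + 1 : ℕ) : ℚ), ((m + 1 : ℕ) : ℚ), (e : ℚ)] := by
    simp [familyExps, List.insertionSort, hlt]
  rw [hf, hexps] at h
  exact h

/-- Every non-zero weight contributes its inverse to `exps` (plumbing). [folklore] -/
private theorem inv_mem_exps_of_ne_zero₁₀ {γ : Fin N → ℚ} {x : Fin N} (hx : γ x ≠ 0) : (γ x)⁻¹ ∈ exps γ := by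
  classical
  unfold exps
  rw [List.mem_insertionSort, List.mem_map]
  exact ⟨x, Finset.mem_toList.2 (Finset.mem_filter.2 ⟨Finset.mem_univ _, hx⟩), rfl⟩

/-- The head of a sorted list is its minimum (plumbing). [folklore] -/
private theorem le_of_mem_of_pairwise₁₀ {c x : ℚ} {es : List ℚ} (hs : (c :: es).Pairwise (· ≤ ·))
    (hx : x ∈ c :: es) : c ≤ x := by
  rcases List.mem_cons.1 hx with rfl | hx
  · exact le_rfl
  · exact (List.pairwise_cons.1 hs).1 x hx

/-- **First face and vertex: nothing in `W(X_a^e + X_b^m X_c)` is above `(m+1, m+1, e)`** (`a, b, c` distinct,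
`1 ≤ m`, `m + 1 < e`, every field, spectators allowed, all polynomial coordinate changes): small weights give the
prefix `(m+1, m+1)` (`τ = 2`) and, by `δ`-preparedness at the vertex `(e/(m+1)) ε_a`, a third entry `≤ (m+1)δ = e`;
a weight `> 1/(m+1)` gives a head `< m+1`. (derived here, from the vertex theorems of
`WeightedCentreVertexPreparation`) [cite: AbramovichTemkinWlodarczyk2024, Thm. 5.3.1 (2) (p. 1578)]
[cite: CossartJannsenSaito2020, Thm. 8.16 (p. 121)] -/
theorem not_lt_of_mem_admissibleInvariants_handlePow (hab : a ≠ b) (hac : a ≠ c) (hbc : b ≠ c) (hm : 1 ≤ m)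
    (he : m + 1 < e) {l : List ℚ} (hl : l ∈ admissibleInvariants (handlePow k a b c e m)) :
    ¬ ATW.TruncLex.lt [((m + 1 : ℕ) : ℚ), ((m + 1 : ℕ) : ℚ), (e : ℚ)] l := by
  classical
  have hν0 : 0 < m + 1 := Nat.succ_pos m
  have hνq : (0 : ℚ) < ((m + 1 : ℕ) : ℚ) := by exact_mod_cast hν0
  have hνe : ((m + 1 : ℕ) : ℚ) < e := by exact_mod_cast he
  have hνδ : ((m + 1 : ℕ) : ℚ) * ((e : ℚ) / ((m + 1 : ℕ) : ℚ)) = e := by field_simp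
  set f := handlePow k a b c e m with hf
  have hord : monomialOrd (fun _ => 1) f = m + 1 := monomialOrd_handlePow hac hbc he.le
  have hin : homogeneousComponent (m + 1) f = X b ^ m * X c := homogeneousComponent_handlePow he
  have hτ : ({b, c} : Finset (Fin N)).card = hironakaTau k {homogeneousComponent (m + 1) f} := by
    rw [hin, hironakaTau_X_pow_mul_X hbc hm, Finset.card_pair hbc]
  have hFS := hFS_handlePow (k := k) (a := a) (b := b) (c := c) he
  have hδ : hironakaDelta {b, c} (m + 1) f = ((((e : ℚ) / ((m + 1 : ℕ) : ℚ)) : ℚ) : WithTop ℚ) :=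
    hironakaDelta_handlePow hab hac hbc
  have hprep : IsDeltaPrepared {b, c} (m + 1) f := isDeltaPrepared_handlePow hab hac hbc hm he
  obtain ⟨Ψ, γ, h, rfl⟩ := hl
  have hsorted := exps_sorted γ
  by_cases hle : ∀ x, γ x ≤ (((m + 1 : ℕ) : ℚ))⁻¹
  · -- `[m+1, m+1]` is a prefix of `exps γ`, and at least three entries are `≤ e`
    obtain ⟨es, hes⟩ : ∃ es, exps γ = ((m + 1 : ℕ) : ℚ) :: ((m + 1 : ℕ) : ℚ) :: es := by
      obtain ⟨t, ht⟩ := replicate_prefix_of_forall_le hord h hle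
      rw [← hτ, Finset.card_pair hbc] at ht
      exact ⟨t, by simpa [List.replicate] using ht.symm⟩
    have hcount := succ_card_le_countP_exps_of_isDeltaPrepared hord hτ hFS hprep hδ h hle
    rw [Finset.card_pair hbc, hνδ, hes, List.countP_cons_of_pos (by simpa using hνe.le),
      List.countP_cons_of_pos (by simpa using hνe.le)] at hcount
    rw [hes] at hsorted
    obtain ⟨e₃, es', rfl⟩ : ∃ e₃ es', es = e₃ :: es' := by
      cases es with
      | nil => simp at hcount
      | cons e₃ es' => exact ⟨e₃, es', rfl⟩
    have hs₃ : (e₃ :: es').Pairwise (· ≤ ·) :=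
      (List.pairwise_cons.1 (List.pairwise_cons.1 hsorted).2).2
    have he₃ : e₃ ≤ e := by
      have hpos : 0 < (e₃ :: es').countP fun x => decide (x ≤ (e : ℚ)) := by omega
      obtain ⟨x, hx, hxe⟩ := List.countP_pos_iff.1 hpos
      exact (le_of_mem_of_pairwise₁₀ hs₃ hx).trans (by simpa using hxe)
    rw [hes, ATW.TruncLex.cons_lt_cons, ATW.TruncLex.cons_lt_cons, ATW.TruncLex.cons_lt_cons]
    rintro (h1 | ⟨-, h2 | ⟨-, h3 | ⟨-, h4⟩⟩⟩)
    · exact lt_irrefl _ h1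
    · exact lt_irrefl _ h2
    · exact not_lt.2 he₃ h3
    · exact ATW.TruncLex.not_nil_lt _ h4
  · -- some weight exceeds `1/(m+1)`: the head of `exps γ` is `< m+1`
    push Not at hle
    obtain ⟨x, hx⟩ := hle
    have hγx : γ x ≠ 0 := (lt_trans (inv_pos.2 hνq) hx).ne'
    have hlt : (γ x)⁻¹ < ((m + 1 : ℕ) : ℚ) := inv_lt_of_inv_lt₀ hνq hx
    have hmem := inv_mem_exps_of_ne_zero₁₀ hγx
    obtain ⟨c₁, cs, hcs⟩ : ∃ c₁ cs, exps γ = c₁ :: cs := by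
      cases hq : exps γ with
      | nil => rw [hq] at hmem; simp at hmem
      | cons c₁ cs => exact ⟨c₁, cs, rfl⟩
    rw [hcs] at hmem hsorted ⊢
    have hc₁ : c₁ < ((m + 1 : ℕ) : ℚ) := (le_of_mem_of_pairwise₁₀ hsorted hmem).trans_lt hlt
    rw [ATW.TruncLex.cons_lt_cons]
    rintro (h1 | ⟨h2, -⟩)
    · exact lt_asymm hc₁ h1
    · exact hc₁.ne' h2

/-- **`max W(X_a^e + X_b^m X_c) = (m+1, m+1, e)`** for pairwise distinct `a, b, c`, `1 ≤ m`, `m + 1 < e`, in EVERY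
field: the coordinate centre realises the invariant, maximised over ALL admissible centres after ALL polynomial
coordinate changes, spectator variables allowed. (derived here)
[cite: AbramovichTemkinWlodarczyk2024, Thm. 5.3.1 (2)–(3) (p. 1578)] [cite: CossartJannsenSaito2020, Thm. 8.16 (p. 121)] -/
theorem isMaxInv_handlePow (hab : a ≠ b) (hac : a ≠ c) (hbc : b ≠ c) (hm : 1 ≤ m) (he : m + 1 < e) :
    IsMaxInv (admissibleInvariants (handlePow k a b c e m))
      [((m + 1 : ℕ) : ℚ), ((m + 1 : ℕ) : ℚ), (e : ℚ)] :=
  ⟨handlePow_inv_mem hab hac hbc he,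
    fun _ hl => not_lt_of_mem_admissibleInvariants_handlePow hab hac hbc hm he hl⟩

/-- The same maximum with the entries written `m + 1`. (derived here)
[cite: AbramovichTemkinWlodarczyk2024, Thm. 5.3.1 (2)–(3) (p. 1578)] -/
theorem isMaxInv_handlePow' (hab : a ≠ b) (hac : a ≠ c) (hbc : b ≠ c) (hm : 1 ≤ m) (he : m + 1 < e) :
    IsMaxInv (admissibleInvariants (X a ^ e + X b ^ m * X c : MvPolynomial (Fin N) k))
      [(m : ℚ) + 1, (m : ℚ) + 1, (e : ℚ)] := by
  have h := isMaxInv_handlePow (k := k) hab hac hbc hm he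
  rw [handlePow_eq] at h
  push_cast at h
  exact h

/-! ## §5 The umbrella family: high and homogeneous regimes -/

section UmbrellaFamily

variable {i j l : Fin N} {p : ℕ}

/-- `handlePow` is the umbrella of `WeightedCentreStepUmbrella` (plumbing).
[cite: Temkin2025, §1.2.2 warning (1) (x² + y²z)] -/
theorem handlePow_eq_umbrella : handlePow k i j l p m = umbrella k i j l p m := rfl

/-- **The umbrella in the HIGH regime: `max W(X_i^p + X_j^m X_l) = (m+1, m+1, p)`** for pairwise distinct
`i, j, l`, `1 ≤ m` and `p > m + 1`, every characteristic (complementing `isMaxInv_umbrella`, the regime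
`2 ≤ p ≤ m`). (derived here) [cite: AbramovichTemkinWlodarczyk2024, Thm. 5.3.1 (2)–(3) (p. 1578)]
[cite: CossartJannsenSaito2020, Thm. 8.16 (p. 121)] -/
theorem isMaxInv_umbrella_high (hij : i ≠ j) (hil : i ≠ l) (hjl : j ≠ l) (hm : 1 ≤ m) (hpm : m + 1 < p) :
    IsMaxInv (admissibleInvariants (umbrella k i j l p m))
      [((m + 1 : ℕ) : ℚ), ((m + 1 : ℕ) : ℚ), (p : ℚ)] :=
  isMaxInv_handlePow hij hil hjl hm hpm

/-- **The homogeneous umbrella: `max W(X_i^{m+1} + X_j^m X_l) = (m+1, m+1, m+1)`** for pairwise distinct `i, j, l`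
and `1 ≤ m`, every characteristic: the polynomial is its own initial form and `τ = 3` (`hironakaTau_umbrella`), so
the coordinate centre is maximal (`isMaxInv_replicate_of_mem`). (derived here)
[cite: AbramovichTemkinWlodarczyk2024, Thm. 5.3.1 (2)–(3) (p. 1578)] [cite: CossartJannsenSaito2020, Def. 1.26 / Lemma 1.27] -/
theorem isMaxInv_umbrella_self (hij : i ≠ j) (hil : i ≠ l) (hjl : j ≠ l) (hm : 1 ≤ m) :
    IsMaxInv (admissibleInvariants (umbrella k i j l (m + 1) m))
      [((m + 1 : ℕ) : ℚ), ((m + 1 : ℕ) : ℚ), ((m + 1 : ℕ) : ℚ)] := by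
  have hmem := umbrella_inv_mem (k := k) hij hil hjl (Nat.succ_pos m) le_rfl
  have hhom : (umbrella k i j l (m + 1) m).IsHomogeneous (m + 1) := by
    rw [umbrella]
    exact (isHomogeneous_X_pow i (m + 1)).add (isHomogeneous_X_pow_mul_X j l m)
  have hτ : hironakaTau k {homogeneousComponent (m + 1) (umbrella k i j l (m + 1) m)} = 3 := by
    rw [homogeneousComponent_of_mem hhom, if_pos rfl]
    exact hironakaTau_umbrella hij hil hjl (Nat.succ_ne_zero m) (by omega)
  have h := isMaxInv_replicate_of_mem (f := umbrella k i j l (m + 1) m) (ν := m + 1)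
    (monomialOrd_umbrella hil hjl le_rfl) (by rw [hτ]; exact hmem)
  rw [hτ] at h
  exact h

/-- The homogeneous umbrella with the entries written `m + 1`. (derived here)
[cite: AbramovichTemkinWlodarczyk2024, Thm. 5.3.1 (2)–(3) (p. 1578)] -/
theorem isMaxInv_umbrella_self' (hij : i ≠ j) (hil : i ≠ l) (hjl : j ≠ l) (hm : 1 ≤ m) :
    IsMaxInv (admissibleInvariants (X i ^ (m + 1) + X j ^ m * X l : MvPolynomial (Fin N) k))
      [(m : ℚ) + 1, (m : ℚ) + 1, (m : ℚ) + 1] := by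
  have h := isMaxInv_umbrella_self (k := k) hij hil hjl hm
  rw [umbrella] at h
  push_cast at h
  exact h

/-- A sorted list with an entry `≤ θ` starts with one (plumbing). [folklore] -/
private theorem head_le_of_countP_pos₁₀ {θ e : ℚ} {es : List ℚ} (hs : (e :: es).Pairwise (· ≤ ·))
    (h : 0 < (e :: es).countP fun x => decide (x ≤ θ)) : e ≤ θ := by
  obtain ⟨x, hx, hxθ⟩ := List.countP_pos_iff.1 h
  exact (le_of_mem_of_pairwise₁₀ hs hx).trans (by simpa using hxθ)

/-- Order bookkeeping for `[a, θ, θ]` (plumbing). [folklore] -/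
private theorem not_lt_triple_of_snd_lt₁₀ {a θ e₂ : ℚ} {rest : List ℚ} (h : e₂ < θ) :
    ¬ ATW.TruncLex.lt [a, θ, θ] (a :: e₂ :: rest) := by
  rw [ATW.TruncLex.cons_lt_cons, ATW.TruncLex.cons_lt_cons]
  rintro (h1 | ⟨-, h2 | ⟨h3, -⟩⟩)
  · exact lt_irrefl _ h1
  · exact lt_asymm h h2
  · exact h.ne' h3

/-- Order bookkeeping for `[a, θ, θ]` (plumbing). [folklore] -/
private theorem not_lt_triple_of_third_le₁₀ {a θ e₃ : ℚ} {rest : List ℚ} (h : e₃ ≤ θ) :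
    ¬ ATW.TruncLex.lt [a, θ, θ] (a :: θ :: e₃ :: rest) := by
  rw [ATW.TruncLex.cons_lt_cons, ATW.TruncLex.cons_lt_cons, ATW.TruncLex.cons_lt_cons]
  rintro (h1 | ⟨-, h2 | ⟨-, h3 | ⟨-, h4⟩⟩⟩)
  · exact lt_irrefl _ h1
  · exact lt_irrefl _ h2
  · exact not_lt.2 h h3
  · exact ATW.TruncLex.not_nil_lt _ h4

/-- Counting bookkeeping for the variables of weight `≥ 1/M` (plumbing). [folklore] -/
private theorem one_add_card_le_card_filter₁₀ {γ : Fin N → ℚ} {i : Fin N} {P M : ℚ} (hP : 0 < P)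
    (hPM : P ≤ M) (hM : 0 < M) (hγi : γ i = P⁻¹) :
    1 + (Finset.univ.filter fun x => x ∉ ({i} : Finset (Fin N)) ∧ γ x = M⁻¹).card ≤
      (Finset.univ.filter fun x => γ x ≠ 0 ∧ (γ x)⁻¹ ≤ M).card := by
  rw [add_comm, ← Finset.card_insert_of_notMem
    (s := Finset.univ.filter fun x => x ∉ ({i} : Finset (Fin N)) ∧ γ x = M⁻¹) (a := i) (by simp)]
  refine Finset.card_le_card fun x hx => ?_
  rw [Finset.mem_insert] at hx
  rw [Finset.mem_filter]
  refine ⟨Finset.mem_univ _, ?_⟩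
  rcases hx with rfl | hx
  · rw [hγi, inv_inv]; exact ⟨inv_ne_zero hP.ne', hPM⟩
  · rw [Finset.mem_filter] at hx
    rw [hx.2.2, inv_inv]; exact ⟨inv_ne_zero hM.ne', le_rfl⟩

/-- **The umbrella is `δ`-prepared with respect to `X_i` for EVERY `p ≥ 2`** (no divisibility hypothesis):
the only candidate vertex `(m ε_j + ε_l)/p` of `Δ(f; X_i)` has `l`-coordinate `1/p`, so it is never a lattice
point and no vertex of the polynomial model exists. (derived here; `isDeltaPrepared_umbrella` assumed
`p ∤ m + 1`) [cite: CossartJannsenSaito2020, Thm. 8.16 / Thm. 8.22 (a) (p. 124) (solvable vertices are lattice points)] -/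
theorem isDeltaPrepared_umbrella_of_two_le (hij : i ≠ j) (hil : i ≠ l) (hjl : j ≠ l) (hp : 2 ≤ p) :
    IsDeltaPrepared {i} p (umbrella k i j l p m) := by
  classical
  intro v hv _ _
  obtain ⟨⟨d, hd, hlt, hco⟩, -⟩ := hv
  have hd' : d ∈ (handlePow k i j l p m).support := hd
  rw [support_handlePow hil hjl, Finset.mem_insert, Finset.mem_singleton] at hd'
  rcases hd' with rfl | rfl
  · rw [blockDeg_singleton, Finsupp.single_eq_same] at hlt
    exact (lt_irrefl _ hlt).elim
  · have h0 : (Finsupp.single j m + Finsupp.single l 1 : Fin N →₀ ℕ) i = 0 := by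
      rw [Finsupp.add_apply, Finsupp.single_apply, Finsupp.single_apply, if_neg (Ne.symm hij),
        if_neg (Ne.symm hil), add_zero]
    rw [blockDeg_singleton, h0, Nat.sub_zero] at hco
    have hli : l ∉ ({i} : Finset (Fin N)) := by
      rw [Finset.mem_singleton]; exact fun h => hil h.symm
    have h1 : (coPart {i} (Finsupp.single j m + Finsupp.single l 1 : Fin N →₀ ℕ)) l = (p • v) l := by
      rw [hco]
    rw [coPart, Finsupp.filter_apply, if_pos hli, Finsupp.add_apply, Finsupp.single_apply, if_neg hjl,
      Finsupp.single_eq_same, Finsupp.smul_apply, smul_eq_mul, zero_add] at h1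
    have h2 : p = 1 := Nat.eq_one_of_mul_eq_one_right h1.symm
    omega

/-! ### The LOW regime in EVERY characteristic: exhaustion of twists

When `char k ∣ p` neither the count for non-integral `δ` nor the count for invertible `ν` applies; the count by
exhaustion of twists (`WeightedCentreTwistExhaustion.hironakaTau_deltaInitial_le_of_forall_twist`) does: for the
umbrella NO degree-`δ` twist `Y_i ↦ Y_i + Ξ(U)` hides a `u`-direction, in any characteristic. -/

/-- An `aeval` fixing the variables of `s` fixes `k[X_s]` (plumbing). [folklore] -/
private theorem aeval_eq_self_of_mem_supported₁₀ {σ' : Type*} {s : Set σ'} (g : σ' → MvPolynomial σ' k)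
    (hg : ∀ v ∈ s, g v = X v) {P : MvPolynomial σ' k} (hP : P ∈ supported k s) : aeval g P = P := by
  have hle : supported k s ≤ AlgHom.equalizer (aeval g) (AlgHom.id k _) := by
    rw [supported_eq_adjoin_X]
    refine Algebra.adjoin_le ?_
    rintro _ ⟨v, hv, rfl⟩
    rw [SetLike.mem_coe, AlgHom.mem_equalizer, AlgHom.id_apply, aeval_X]
    exact hg v hv
  exact (AlgHom.mem_equalizer _ _ _).mp (hle hP)

/-- An `aeval` maps `k[X_s]` into any subalgebra containing the images of `X_v`, `v ∈ s` (plumbing). [folklore] -/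
private theorem aeval_mem_of_mem_supported₁₀ {σ' : Type*} {s : Set σ'} (g : σ' → MvPolynomial σ' k)
    {A : Subalgebra k (MvPolynomial σ' k)} (hg : ∀ v ∈ s, g v ∈ A) {P : MvPolynomial σ' k}
    (hP : P ∈ supported k s) : aeval g P ∈ A := by
  have hle : supported k s ≤ A.comap (aeval g) := by
    rw [supported_eq_adjoin_X]
    refine Algebra.adjoin_le ?_
    rintro _ ⟨v, hv, rfl⟩
    rw [SetLike.mem_coe, Subalgebra.mem_comap, aeval_X]
    exact hg v hv
  exact hle hP

/-- `∂_v P = 0` for `P ∈ k[X_s]`, `v ∉ s` (plumbing). [folklore] -/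
private theorem pderiv_eq_zero_of_mem_supported₁₀ {σ' : Type*} {s : Set σ'} {v : σ'} (hv : v ∉ s)
    {P : MvPolynomial σ' k} (hP : P ∈ supported k s) : pderiv v P = 0 :=
  pderiv_eq_zero_of_notMem_vars fun h => hv (mem_supported.1 hP (Finset.mem_coe.2 h))

/-- **Exhaustion of twists for the umbrella (every characteristic).**  If a direction `c` with `c_i = 0` leaves a
twisted umbrella `(X_i + Ξ(U))^p + X_j^m X_l` (`Ξ ∈ k[U]`, `U = X_{≠ i}`) translation-invariant, then
`c_j = c_l = 0`.  Proof: after the shift `Y_i ↦ Y_i − Ξ` the invariance reads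
`(Y_i + D)^p + (Y_j + c_jT)^m (Y_l + c_lT) = Y_i^p + Y_j^m Y_l` with `D = Ξ(U + cT) − Ξ(U) ∈ k[U, T]`; killing `Y_i`
gives `D^p + (Y_j + c_jT)^m (Y_l + c_lT) = Y_j^m Y_l`.  If `p ≠ 0` in `k`, `∂/∂Y_i` and killing `Y_i` give
`D^{p-1} = 0`, so `D = 0` and the handle is invariant, whence `c_j = c_l = 0` (`τ(Y_j^m Y_l) = 2`); if `p = 0` in
`k`, `∂/∂Y_l` gives `(Y_j + c_jT)^m = Y_j^m`, so `c_j = 0`, and then `∂/∂T` gives `c_l Y_j^m = 0`. (derived here)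
[cite: CossartJannsenSaito2020, Def. 8.13 (pp. 120–121), Thm. 8.22 (a) (p. 124); CossartPiltant2008, proof of Prop. 4.2] -/
theorem eq_zero_of_mem_invarianceSpace_twist_umbrella (hij : i ≠ j) (hil : i ≠ l) (hjl : j ≠ l)
    (hp : 2 ≤ p) (hm : 1 ≤ m) {c : Fin N → k} (hci : c i = 0) {Ξ : Fin N → MvPolynomial (Fin N) k}
    (hΞ : ∀ d ∈ (Ξ i).support, d i = 0)
    (hc : c ∈ invarianceSpace k {twist {i} Ξ (umbrella k i j l p m)}) : c j = 0 ∧ c l = 0 := by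
  classical
  have hp0 : p ≠ 0 := by omega
  have hp1 : p - 1 ≠ 0 := by omega
  have hm0 : m ≠ 0 := by omega
  have hji : (some j : Option (Fin N)) ≠ some i := fun h => hij (Option.some_injective _ h).symm
  have hli : (some l : Option (Fin N)) ≠ some i := fun h => hil (Option.some_injective _ h).symm
  have hjl' : (some j : Option (Fin N)) ≠ some l := fun h => hjl (Option.some_injective _ h)
  have hni : (none : Option (Fin N)) ≠ some i := (Option.some_ne_none i).symm
  have hnj : (none : Option (Fin N)) ≠ some j := (Option.some_ne_none j).symm
  have hnl : (none : Option (Fin N)) ≠ some l := (Option.some_ne_none l).symm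
  have hjn : (some j : Option (Fin N)) ≠ none := Option.some_ne_none j
  -- the twisted umbrella and its translate
  have hF : twist {i} Ξ (umbrella k i j l p m) = (X i + Ξ i) ^ p + X j ^ m * X l := by
    rw [umbrella, map_add, map_pow, map_mul, map_pow, twist_X_of_mem Ξ (Finset.mem_singleton_self i),
      twist_X_of_not_mem Ξ (fun h => hij (Finset.mem_singleton.1 h).symm),
      twist_X_of_not_mem Ξ (fun h => hil (Finset.mem_singleton.1 h).symm)]
  have h := (mem_invarianceSpace_iff k).1 hc _ (Set.mem_singleton _)
  rw [hF] at h
  simp only [map_add, map_mul, map_pow, rename_X, translate_X_some, hci, C_0, zero_mul, add_zero] at h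
  -- h : (Y_i + translate (rename some Ξ_i))^p + (Y_j + c_j T)^m (Y_l + c_l T) = (Y_i + rename some Ξ_i)^p + Y_j^m Y_l
  set Ξ' : MvPolynomial (Option (Fin N)) k := rename some (Ξ i) with hΞ'
  set Θ : MvPolynomial (Option (Fin N)) k := translate k c Ξ' with hΘ
  -- `Ξ'`, `Θ` and the handles live in `k[X_s]`, `s = {v ≠ Y_i}`
  set s : Set (Option (Fin N)) := {v | v ≠ some i} with hs
  have hnot : (some i : Option (Fin N)) ∉ s := fun h => by
    rw [hs, Set.mem_setOf_eq] at h
    exact h rfl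
  have hXmem : ∀ v : Option (Fin N), v ≠ some i → (X v : MvPolynomial (Option (Fin N)) k) ∈ supported k s :=
    fun v hv => X_mem_supported.2 hv
  have hCmem : ∀ r : k, (C r : MvPolynomial (Option (Fin N)) k) ∈ supported k s := fun r => by
    rw [← MvPolynomial.algebraMap_eq]; exact Subalgebra.algebraMap_mem _ r
  have hΞ's : Ξ' ∈ supported k s := by
    rw [mem_supported]
    intro v hv
    obtain ⟨x, hx, rfl⟩ := Finset.mem_image.1 (vars_rename some (Ξ i) (Finset.mem_coe.1 hv))
    obtain ⟨d, hd, hxd⟩ := (mem_vars_iff_mem_support x).1 hx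
    show some x ≠ some i
    intro hxi
    have hdx : d x ≠ 0 := Finsupp.mem_support_iff.1 hxd
    rw [Option.some_injective _ hxi] at hdx
    exact hdx (hΞ d hd)
  have hΘs : Θ ∈ supported k s := by
    have hΘ' : Θ = aeval (fun o : Option (Fin N) => o.elim (X none) fun x => X (some x) + C (c x) * X none) Ξ' :=
      rfl
    rw [hΘ']
    refine aeval_mem_of_mem_supported₁₀ _ (fun v hv => ?_) hΞ's
    cases v with
    | none => exact hXmem none hni
    | some x => exact add_mem (hXmem _ hv) (mul_mem (hCmem _) (hXmem _ hni))
  have hHs : ((X (some j) + C (c j) * X none) ^ m * (X (some l) + C (c l) * X none) :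
      MvPolynomial (Option (Fin N)) k) ∈ supported k s :=
    mul_mem (pow_mem (add_mem (hXmem _ hji) (mul_mem (hCmem _) (hXmem _ hni))) m)
      (add_mem (hXmem _ hli) (mul_mem (hCmem _) (hXmem _ hni)))
  have hH0s : (X (some j) ^ m * X (some l) : MvPolynomial (Option (Fin N)) k) ∈ supported k s :=
    mul_mem (pow_mem (hXmem _ hji) m) (hXmem _ hli)
  -- the shift `Y_i ↦ Y_i - Ξ'`
  obtain ⟨σ, hσi, hσfix⟩ : ∃ σ : MvPolynomial (Option (Fin N)) k →ₐ[k] MvPolynomial (Option (Fin N)) k,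
      σ (X (some i)) = X (some i) - Ξ' ∧ ∀ P ∈ supported k s, σ P = P :=
    ⟨aeval fun v => if v = some i then X (some i) - Ξ' else X v, by rw [aeval_X, if_pos rfl],
      fun P hP => aeval_eq_self_of_mem_supported₁₀ _ (fun v hv => if_neg hv) hP⟩
  have h2 := congrArg σ h
  simp only [map_add, map_pow, hσi, hσfix _ hΘs, hσfix _ hΞ's, hσfix _ hHs, hσfix _ hH0s,
    sub_add_cancel] at h2
  set D : MvPolynomial (Option (Fin N)) k := Θ - Ξ' with hD
  have hDs : D ∈ supported k s := sub_mem hΘs hΞ's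
  rw [show X (some i) - Ξ' + Θ = X (some i) + D by rw [hD]; ring] at h2
  -- h2 : (Y_i + D)^p + (Y_j + c_j T)^m (Y_l + c_l T) = Y_i^p + Y_j^m Y_l
  have hκfix : ∀ P ∈ supported k s, killVar (some i) P = P := fun P hP =>
    aeval_eq_self_of_mem_supported₁₀ _ (fun v hv => if_neg hv) hP
  have h3 := congrArg (killVar (some i)) h2
  simp only [map_add, map_pow, killVar_X, if_true, hκfix _ hDs, hκfix _ hHs, hκfix _ hH0s, zero_add,
    zero_pow hp0] at h3
  -- h3 : D^p + (Y_j + c_j T)^m (Y_l + c_l T) = Y_j^m Y_l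
  have hnat : ((p : ℕ) : MvPolynomial (Option (Fin N)) k) = C (p : k) := (map_natCast C p).symm
  by_cases hpk : (p : k) = 0
  · -- `char k ∣ p`
    have hpR : ((p : ℕ) : MvPolynomial (Option (Fin N)) k) = 0 := by rw [hnat, hpk, C_0]
    have h4 := congrArg (pderiv (some l)) h3
    simp only [map_add, pderiv_mul, pderiv_pow, hpR, zero_mul, zero_add, pderiv_C, pderiv_X_self,
      pderiv_X_of_ne hjl', pderiv_X_of_ne hnl, mul_zero, add_zero, mul_one] at h4
    -- h4 : (Y_j + c_j T)^m = Y_j^m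
    have hβ : c j = 0 := by
      have h5 := congrArg (killVar (some j)) h4
      simp only [map_add, map_mul, map_pow, killVar_X, killVar_C'', if_true, hnj, if_false, zero_add,
        zero_pow hm0] at h5
      by_contra hne
      exact pow_ne_zero m (mul_ne_zero (fun h' => hne (C_eq_zero.1 h')) (X_ne_zero none)) h5
    rw [hβ, C_0, zero_mul, add_zero] at h3
    -- h3 : D^p + Y_j^m (Y_l + c_l T) = Y_j^m Y_l
    have h6 : D ^ p + X (some j) ^ m * (C (c l) * X none) = 0 := by linear_combination h3
    have h7 := congrArg (pderiv none) h6
    simp only [map_add, map_zero, pderiv_mul, pderiv_pow, hpR, zero_mul, zero_add, pderiv_C,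
      pderiv_X_self, pderiv_X_of_ne hjn, mul_zero, mul_one] at h7
    -- h7 : Y_j^m * C (c l) = 0
    have hγ : c l = 0 := by
      by_contra hne
      exact mul_ne_zero (pow_ne_zero m (X_ne_zero (some j))) (fun h' => hne (C_eq_zero.1 h')) h7
    exact ⟨hβ, hγ⟩
  · -- `p` invertible in `k`
    have hpR : ((p : ℕ) : MvPolynomial (Option (Fin N)) k) ≠ 0 := by
      rw [hnat]; exact fun h' => hpk (C_eq_zero.1 h')
    have hDi : pderiv (some i) D = 0 := pderiv_eq_zero_of_mem_supported₁₀ hnot hDs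
    have hHi : pderiv (some i) ((X (some j) + C (c j) * X none) ^ m * (X (some l) + C (c l) * X none) :
        MvPolynomial (Option (Fin N)) k) = 0 := pderiv_eq_zero_of_mem_supported₁₀ hnot hHs
    have hH0i : pderiv (some i) (X (some j) ^ m * X (some l) : MvPolynomial (Option (Fin N)) k) = 0 :=
      pderiv_eq_zero_of_mem_supported₁₀ hnot hH0s
    have h4 := congrArg (pderiv (some i)) h2
    simp only [map_add, hHi, hH0i, add_zero, pderiv_pow, hDi, pderiv_X_self, mul_one] at h4
    -- h4 : p (Y_i + D)^(p-1) = p Y_i^(p-1)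
    have h5 : (X (some i) + D) ^ (p - 1) = X (some i) ^ (p - 1) := mul_left_cancel₀ hpR h4
    have h6 := congrArg (killVar (some i)) h5
    simp only [map_add, map_pow, killVar_X, if_true, hκfix _ hDs, zero_add, zero_pow hp1] at h6
    -- h6 : D^(p-1) = 0
    have hD0 : D = 0 := (pow_eq_zero_iff hp1).1 h6
    rw [hD0, zero_pow hp0, zero_add] at h3
    exact eq_zero_of_translate_handle hjl hm h3

/-- A direction off `X_i, X_j, X_l` leaves the umbrella invariant (plumbing).
[cite: CossartJannsenSaito2020, Def. 1.26 / Lemma 1.27] -/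
theorem mem_invarianceSpace_umbrella {c : Fin N → k} (hci : c i = 0) (hcj : c j = 0) (hcl : c l = 0) :
    c ∈ invarianceSpace k {umbrella k i j l p m} := by
  refine (mem_invarianceSpace_iff k).2 fun F hF => ?_
  rw [Set.mem_singleton_iff] at hF
  subst hF
  simp only [umbrella, map_add, map_mul, map_pow, rename_X, translate_X_some, hci, hcj, hcl, C_0, zero_mul,
    add_zero]

/-- **The umbrella in the LOW regime in EVERY characteristic: `max W(X_i^p + X_j^m X_l) = (p, m+1, m+1)`**
for pairwise distinct `i, j, l` and `2 ≤ p ≤ m` — no divisibility or invertibility hypothesis (so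
`X_i² + X_j³ X_l ↦ (2, 4, 4)` also in characteristic `2`).  Same frame as `isMaxInv_umbrella`, with the `δ`-face
count by EXHAUSTION OF TWISTS (`hironakaTau_deltaInitial_le_of_forall_twist`), whose hypothesis is
`eq_zero_of_mem_invarianceSpace_twist_umbrella`. (derived here)
[cite: AbramovichTemkinWlodarczyk2024, Thm. 5.3.1 (2)–(3) (p. 1578)] [cite: CossartJannsenSaito2020, Thm. 8.16 (p. 121), Thm. 8.22 (a) (p. 124)] -/
theorem isMaxInv_umbrella_low (hij : i ≠ j) (hil : i ≠ l) (hjl : j ≠ l) (hp : 2 ≤ p) (hpm : p ≤ m) :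
    IsMaxInv (admissibleInvariants (umbrella k i j l p m)) [(p : ℚ), ((m + 1 : ℕ) : ℚ), ((m + 1 : ℕ) : ℚ)] := by
  classical
  set f := umbrella k i j l p m with hf
  set M : ℚ := ((m + 1 : ℕ) : ℚ) with hM
  have hp0 : 0 < p := by omega
  have hm0 : m ≠ 0 := by omega
  have hpq : (0 : ℚ) < p := by exact_mod_cast hp0
  have hpM : (p : ℚ) < M := by rw [hM]; exact_mod_cast Nat.lt_succ_of_le hpm
  have hM0 : (0 : ℚ) < M := hpq.trans hpM
  have hpδ : (p : ℚ) * (M / p) = M := by field_simp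
  -- the inputs of the vertex theorems
  have hord : monomialOrd (fun _ => 1) f = p := monomialOrd_umbrella hil hjl (by omega)
  have hin : homogeneousComponent p f = X i ^ p := homogeneousComponent_umbrella (by omega)
  have hτ : ({i} : Finset (Fin N)).card = hironakaTau k {homogeneousComponent p f} := by
    rw [hin, hironakaTau_X_pow i hp0.ne', Finset.card_singleton]
  have hFS : ∀ d ∈ (homogeneousComponent p f).support, ∀ x ∉ ({i} : Finset (Fin N)), d x = 0 := by
    intro d hd x hx
    rw [hin, X_pow_eq_monomial] at hd
    have hd' := Finset.mem_singleton.1 (support_monomial_subset hd)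
    rw [Finset.mem_singleton] at hx
    rw [hd', Finsupp.single_apply, if_neg (Ne.symm hx)]
  have hδ : hironakaDelta {i} p f = ((M / p : ℚ) : WithTop ℚ) := hironakaDelta_umbrella hij hil hjl hp0
  have hprep : IsDeltaPrepared {i} p f := isDeltaPrepared_umbrella_of_two_le hij hil hjl hp
  have hinδ : deltaInitial {i} p (M / p) f = umbrella k i j l p m := by
    rw [hf, hM]; exact deltaInitial_umbrella hij hil hp0
  have hτδ : hironakaTau k {deltaInitial {i} p (M / p) f} = 3 := by
    rw [hinδ]; exact hironakaTau_umbrella hij hil hjl hp0.ne' hm0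
  -- exhaustion of twists: no degree-`δ` twist hides a `u`-direction
  have hcount : ∀ c : Fin N → k, (∀ x ∈ ({i} : Finset (Fin N)), c x = 0) →
      c ∉ invarianceSpace k {deltaInitial {i} p (M / p) f} →
      ∀ Ξ : Fin N → MvPolynomial (Fin N) k,
        (∀ x ∈ ({i} : Finset (Fin N)), ∀ d ∈ (Ξ x).support, blockDeg {i} d = 0 ∧ (d.degree : ℚ) = M / p) →
        c ∉ invarianceSpace k {twist {i} Ξ (deltaInitial {i} p (M / p) f)} := by
    intro c hcS hcW Ξ hΞ hcT
    rw [hinδ] at hcW hcT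
    have hci : c i = 0 := hcS i (Finset.mem_singleton_self i)
    have hΞi : ∀ d ∈ (Ξ i).support, d i = 0 := fun d hd => by
      have h := (hΞ i (Finset.mem_singleton_self i) d hd).1
      rwa [blockDeg_singleton] at h
    obtain ⟨hcj, hcl⟩ :=
      eq_zero_of_mem_invarianceSpace_twist_umbrella hij hil hjl hp (by omega) hci hΞi hcT
    exact hcW (mem_invarianceSpace_umbrella hci hcj hcl)
  refine ⟨umbrella_inv_mem hij hil hjl hp0 (by omega), ?_⟩
  rintro b ⟨Ψ, γ, h, rfl⟩
  have hsorted := exps_sorted γ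
  have hγpos : ∀ x, γ x ≠ 0 → 0 < γ x := fun x hx => lt_of_le_of_ne (h.2.1 x) (Ne.symm hx)
  by_cases hle : ∀ x, γ x ≤ (p : ℚ)⁻¹
  · -- `[p]` is a prefix of `exps γ`, and at least two entries are `≤ M`
    obtain ⟨es, hes⟩ : ∃ es, exps γ = (p : ℚ) :: es := by
      obtain ⟨t, ht⟩ := replicate_prefix_of_forall_le hord h hle
      rw [← hτ, Finset.card_singleton, List.replicate_one] at ht
      exact ⟨t, ht.symm⟩
    have hcount' := succ_card_le_countP_exps_of_isDeltaPrepared hord hτ hFS hprep hδ h hle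
    rw [Finset.card_singleton, hpδ, hes, List.countP_cons_of_pos (by simpa using hpM.le)] at hcount'
    rw [hes] at hsorted
    obtain ⟨e₂, es', rfl⟩ : ∃ e₂ es', es = e₂ :: es' := by
      cases es with
      | nil => simp at hcount'
      | cons e₂ es' => exact ⟨e₂, es', rfl⟩
    have hs₂ : (e₂ :: es').Pairwise (· ≤ ·) := (List.pairwise_cons.1 hsorted).2
    have he₂ : e₂ ≤ M := head_le_of_countP_pos₁₀ hs₂ (by omega)
    rw [hes]
    by_cases heq₂ : e₂ = M
    swap
    · exact not_lt_triple_of_snd_lt₁₀ (lt_of_le_of_ne he₂ heq₂)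
    rw [heq₂] at hes hs₂ ⊢
    -- exactly one entry of `exps γ` is `≤ p`: the variable `x₀` of weight `1/p`
    have hes' : ∀ x ∈ es', M ≤ x := (List.pairwise_cons.1 hs₂).1
    have hcountp : (exps γ).countP (fun x => decide (x ≤ (p : ℚ))) = 1 := by
      rw [hes, List.countP_cons_of_pos (by simp), List.countP_cons_of_neg (by simpa using hpM),
        List.countP_eq_zero.2 (fun x hx => by simpa using hpM.trans_le (hes' x hx))]
    rw [countP_exps] at hcountp
    obtain ⟨x₀, hx₀⟩ := Finset.card_eq_one.1 hcountp
    have hx₀' : γ x₀ ≠ 0 ∧ (γ x₀)⁻¹ ≤ (p : ℚ) := by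
      have : x₀ ∈ ({x₀} : Finset (Fin N)) := Finset.mem_singleton_self x₀
      rw [← hx₀, Finset.mem_filter] at this
      exact this.2
    have hγx₀ : γ x₀ = (p : ℚ)⁻¹ :=
      le_antisymm (hle x₀) (inv_le_of_inv_le₀ (hγpos x₀ hx₀'.1) hx₀'.2)
    have hothers : ∀ x, x ≠ x₀ → γ x ≤ M⁻¹ := by
      intro x hx
      by_cases h0 : γ x = 0
      · rw [h0]; exact inv_nonneg.2 hM0.le
      have hnot : ¬ (γ x)⁻¹ ≤ (p : ℚ) := by
        intro hle'
        apply hx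
        have : x ∈ ({x₀} : Finset (Fin N)) := by
          rw [← hx₀, Finset.mem_filter]; exact ⟨Finset.mem_univ _, h0, hle'⟩
        exact Finset.mem_singleton.1 this
      have hmem := inv_mem_exps_of_ne_zero₁₀ h0
      rw [hes, List.mem_cons] at hmem
      rcases hmem with heq | hmem
      · exact absurd heq.le hnot
      · exact le_inv_of_le_inv₀ hM0 (le_of_mem_of_pairwise₁₀ hs₂ hmem)
    -- move `x₀` to `i` and count the variables of weight exactly `1/M`
    set π : Equiv.Perm (Fin N) := Equiv.swap i x₀ with hπ
    have h' := h.perm π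
    have hπi : π i = x₀ := Equiv.swap_apply_left i x₀
    have hπne : ∀ x, x ≠ i → π x ≠ x₀ := by
      intro x hx heq
      apply hx
      apply π.injective
      rw [heq, hπi]
    have hγS : ∀ x ∈ ({i} : Finset (Fin N)), (γ ∘ π) x = (p : ℚ)⁻¹ := by
      intro x hx
      rw [Finset.mem_singleton] at hx
      rw [hx, Function.comp_apply, hπi, hγx₀]
    have hγle : ∀ x ∉ ({i} : Finset (Fin N)), (γ ∘ π) x ≤ ((p : ℚ) * (M / p))⁻¹ := by
      intro x hx
      rw [Finset.mem_singleton] at hx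
      rw [hpδ, Function.comp_apply]
      exact hothers _ (hπne x hx)
    have hbound := hironakaTau_deltaInitial_le_of_forall_twist hord hτ hFS hprep hδ hcount h' hγS hγle
    rw [hτδ, Finset.card_singleton, hpδ] at hbound
    have hcnt : 3 ≤ (exps (γ ∘ π)).countP (fun x => decide (x ≤ M)) := by
      rw [countP_exps]
      exact hbound.trans (one_add_card_le_card_filter₁₀ hpq hpM.le hM0
        (by rw [Function.comp_apply, hπi, hγx₀]))
    rw [exps_comp_perm, hes, List.countP_cons_of_pos (by simpa using hpM.le),
      List.countP_cons_of_pos (by simp)] at hcnt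
    cases es' with
    | nil => simp at hcnt
    | cons e₃ es'' =>
      have hs₃ : (e₃ :: es'').Pairwise (· ≤ ·) := (List.pairwise_cons.1 hs₂).2
      exact not_lt_triple_of_third_le₁₀ (head_le_of_countP_pos₁₀ hs₃ (by omega))
  · -- some weight exceeds `1/p`: then the head of `exps γ` is `< p`
    push Not at hle
    obtain ⟨x, hx⟩ := hle
    have hγx : γ x ≠ 0 := (lt_trans (inv_pos.2 hpq) hx).ne'
    have hlt : (γ x)⁻¹ < p := inv_lt_of_inv_lt₀ hpq hx
    have hmem := inv_mem_exps_of_ne_zero₁₀ hγx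
    obtain ⟨e, es, hes⟩ : ∃ e es, exps γ = e :: es := by
      cases hq : exps γ with
      | nil => rw [hq] at hmem; simp at hmem
      | cons e es => exact ⟨e, es, rfl⟩
    rw [hes] at hmem hsorted ⊢
    have he : e < p := (le_of_mem_of_pairwise₁₀ hsorted hmem).trans_lt hlt
    rw [ATW.TruncLex.cons_lt_cons]
    rintro (h1 | ⟨h2, -⟩)
    · exact lt_asymm he h1
    · exact he.ne' h2

/-- **The umbrella family law `max W(X_i^p + X_j^m X_l) = sort (p, m+1, m+1)` in EVERY characteristic**
(`i, j, l` pairwise distinct, `p ≥ 2`, `m ≥ 1`, any number of spectator variables): the census's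
one-pure-power-one-handle law (engine 1, C136 (d)) with all three regimes glued — LOW `p ≤ m`
(`isMaxInv_umbrella_low`, the pure power is the initial form), HOMOGENEOUS `p = m + 1` (`isMaxInv_umbrella_self`),
HIGH `p > m + 1` (`isMaxInv_umbrella_high`, the handle is the initial form). (derived here)
[cite: AbramovichTemkinWlodarczyk2024, Thm. 5.3.1 (2)–(3) (p. 1578)] [cite: CossartJannsenSaito2020, Thm. 8.16 (p. 121)] -/
theorem isMaxInv_umbrella_law (hij : i ≠ j) (hil : i ≠ l) (hjl : j ≠ l) (hp : 2 ≤ p) (hm : 1 ≤ m) :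
    IsMaxInv (admissibleInvariants (umbrella k i j l p m))
      (if p ≤ m + 1 then [(p : ℚ), ((m + 1 : ℕ) : ℚ), ((m + 1 : ℕ) : ℚ)]
        else [((m + 1 : ℕ) : ℚ), ((m + 1 : ℕ) : ℚ), (p : ℚ)]) := by
  split_ifs with h
  · rcases Nat.lt_or_eq_of_le h with h' | h'
    · exact isMaxInv_umbrella_low hij hil hjl hp (by omega)
    · subst h'
      exact isMaxInv_umbrella_self hij hil hjl hm
  · exact isMaxInv_umbrella_high hij hil hjl hm (by omega)

/-- The law, unfolded: `max W(X_a^e + X_b^m X_c) = sort (e, m+1, m+1)` for `e ≥ 2`, `m ≥ 1`, `a, b, c` distinct,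
every field. (derived here) [cite: AbramovichTemkinWlodarczyk2024, Thm. 5.3.1 (2)–(3) (p. 1578)] -/
theorem isMaxInv_X_pow_add_X_pow_mul_X (hij : i ≠ j) (hil : i ≠ l) (hjl : j ≠ l) (hp : 2 ≤ p) (hm : 1 ≤ m) :
    IsMaxInv (admissibleInvariants (X i ^ p + X j ^ m * X l : MvPolynomial (Fin N) k))
      (if p ≤ m + 1 then [(p : ℚ), (m : ℚ) + 1, (m : ℚ) + 1] else [(m : ℚ) + 1, (m : ℚ) + 1, (p : ℚ)]) := by
  have h := isMaxInv_umbrella_law (k := k) hij hil hjl hp hm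
  rw [umbrella] at h
  push_cast at h
  exact h

end UmbrellaFamily

/-! ## §6 Worked instances -/

/-- **`A_{e-1}`: `max W(X_a^e + X_b X_c) = (2, 2, e)`** for `e ≥ 3` and distinct `a, b, c`, every field,
spectators allowed (`e = 2` is the node, value `(2, 2, 2)` — not this theorem). (derived here)
[cite: AbramovichTemkinWlodarczyk2024, Thm. 5.3.1 (2)–(3) (p. 1578)] -/
theorem isMaxInv_X_pow_add_X_mul_X (hab : a ≠ b) (hac : a ≠ c) (hbc : b ≠ c) (he : 3 ≤ e) :
    IsMaxInv (admissibleInvariants (X a ^ e + X b * X c : MvPolynomial (Fin N) k)) [2, 2, (e : ℚ)] := by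
  have h := isMaxInv_handlePow' (k := k) (m := 1) hab hac hbc le_rfl (show 1 + 1 < e by omega)
  rw [pow_one] at h
  norm_num at h
  exact h

/-- `x⁵ + y² z ↦ (3, 3, 5)`, every field. (derived here) [cite: AbramovichTemkinWlodarczyk2024, Thm. 5.3.1 (2)–(3) (p. 1578)] -/
example : IsMaxInv (admissibleInvariants (X 0 ^ 5 + X 1 ^ 2 * X 2 : MvPolynomial (Fin 3) k)) [3, 3, 5] := by
  have h := isMaxInv_handlePow' (k := k) (N := 3) (a := 0) (b := 1) (c := 2) (e := 5) (m := 2)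
    (by decide) (by decide) (by decide) (by norm_num) (by norm_num)
  norm_num at h
  exact h

/-- `A₂` in four variables (one spectator): `x³ + y z ↦ (2, 2, 3)`, every field. (derived here)
[cite: AbramovichTemkinWlodarczyk2024, Thm. 5.3.1 (2)–(3) (p. 1578)] -/
example : IsMaxInv (admissibleInvariants (X 0 ^ 3 + X 1 * X 2 : MvPolynomial (Fin 4) k)) [2, 2, 3] := by
  have h := isMaxInv_X_pow_add_X_mul_X (k := k) (N := 4) (a := 0) (b := 1) (c := 2) (e := 3)
    (by decide) (by decide) (by decide) le_rfl
  norm_num at h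
  exact h

/-- The cubic cone `x³ + y² z ↦ (3, 3, 3)` (homogeneous umbrella, `m = 2`), every field. (derived here)
[cite: AbramovichTemkinWlodarczyk2024, Thm. 5.3.1 (2)–(3) (p. 1578)] -/
example : IsMaxInv (admissibleInvariants (X 0 ^ 3 + X 1 ^ 2 * X 2 : MvPolynomial (Fin 3) k)) [3, 3, 3] := by
  have h := isMaxInv_umbrella_self' (k := k) (N := 3) (i := 0) (j := 1) (l := 2) (m := 2)
    (by decide) (by decide) (by decide) (by norm_num)
  norm_num at h
  exact h

/-- The node `x² + y z ↦ (2, 2, 2)` (homogeneous umbrella, `m = 1`), every field. (derived here)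
[cite: AbramovichTemkinWlodarczyk2024, Thm. 5.3.1 (2)–(3) (p. 1578)] -/
example : IsMaxInv (admissibleInvariants (X 0 ^ 2 + X 1 * X 2 : MvPolynomial (Fin 3) k)) [2, 2, 2] := by
  have h := isMaxInv_umbrella_self' (k := k) (N := 3) (i := 0) (j := 1) (l := 2) (m := 1)
    (by decide) (by decide) (by decide) le_rfl
  rw [pow_one] at h
  norm_num at h
  exact h

/-- `x² + y³ z ↦ (2, 4, 4)` in EVERY field — including characteristic `2`, where `p = 2 ∣ m + 1 = 4` and
`char k ∣ p` put it outside both `isMaxInv_umbrella` and the count for invertible `ν`. (derived here)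
[cite: AbramovichTemkinWlodarczyk2024, Thm. 5.3.1 (2)–(3) (p. 1578)] -/
example : IsMaxInv (admissibleInvariants (X 0 ^ 2 + X 1 ^ 3 * X 2 : MvPolynomial (Fin 3) k)) [2, 4, 4] := by
  have h := isMaxInv_umbrella_low (k := k) (N := 3) (i := 0) (j := 1) (l := 2) (p := 2) (m := 3)
    (by decide) (by decide) (by decide) le_rfl (by norm_num)
  rw [umbrella] at h
  norm_num at h
  exact h

/-- `x³ + y⁵ z ↦ (3, 6, 6)` in characteristic `3` (`3 ∣ 6`, `char = p`). (derived here)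
[cite: AbramovichTemkinWlodarczyk2024, Thm. 5.3.1 (2)–(3) (p. 1578)] -/
example [CharP k 3] :
    IsMaxInv (admissibleInvariants (X 0 ^ 3 + X 1 ^ 5 * X 2 : MvPolynomial (Fin 3) k)) [3, 6, 6] := by
  have h := isMaxInv_umbrella_low (k := k) (N := 3) (i := 0) (j := 1) (l := 2) (p := 3) (m := 5)
    (by decide) (by decide) (by decide) (by norm_num) (by norm_num)
  rw [umbrella] at h
  norm_num at h
  exact h

/-- The law on `x⁴ + y² z` (HIGH, `↦ (3, 3, 4)`), `x³ + y² z` (homogeneous, `↦ (3, 3, 3)`) and `x² + y² z`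
(LOW, Whitney-type, `↦ (2, 3, 3)`), every field, one theorem. (derived here)
[cite: AbramovichTemkinWlodarczyk2024, Thm. 5.3.1 (2)–(3) (p. 1578)] -/
example : IsMaxInv (admissibleInvariants (X 0 ^ 4 + X 1 ^ 2 * X 2 : MvPolynomial (Fin 3) k)) [3, 3, 4] ∧
    IsMaxInv (admissibleInvariants (X 0 ^ 3 + X 1 ^ 2 * X 2 : MvPolynomial (Fin 3) k)) [3, 3, 3] ∧
    IsMaxInv (admissibleInvariants (X 0 ^ 2 + X 1 ^ 2 * X 2 : MvPolynomial (Fin 3) k)) [2, 3, 3] := by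
  have h4 := isMaxInv_X_pow_add_X_pow_mul_X (k := k) (N := 3) (i := 0) (j := 1) (l := 2) (p := 4) (m := 2)
    (by decide) (by decide) (by decide) (by norm_num) (by norm_num)
  have h3 := isMaxInv_X_pow_add_X_pow_mul_X (k := k) (N := 3) (i := 0) (j := 1) (l := 2) (p := 3) (m := 2)
    (by decide) (by decide) (by decide) (by norm_num) (by norm_num)
  have h2 := isMaxInv_X_pow_add_X_pow_mul_X (k := k) (N := 3) (i := 0) (j := 1) (l := 2) (p := 2) (m := 2)
    (by decide) (by decide) (by decide) (by norm_num) (by norm_num)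
  norm_num at h4 h3 h2
  exact ⟨h4, h3, h2⟩

/-- `y³ z ↦ (4, 4)`, every field. (derived here) [cite: AbramovichTemkinWlodarczyk2024, Thm. 5.3.1 (2)–(3) (p. 1578)] -/
example : IsMaxInv (admissibleInvariants (X 1 ^ 3 * X 2 : MvPolynomial (Fin 3) k)) [4, 4] := by
  have h := isMaxInv_X_pow_mul_X (k := k) (N := 3) (b := 1) (c := 2) (m := 3) (by decide) (by norm_num)
  norm_num at h
  exact h

end Literature.AlgebraicGeometry.Resolution.WeightedBlowup

end
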